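import Literature.AlgebraicGeometry.Frobenioids.Thm42SubProofsL02
import Literature.AlgebraicGeometry.Frobenioids.Thm42DivIdentityPreserved
import Literature.AlgebraicGeometry.Frobenioids.Thm42PrimaryStepsReflect
import Literature.AlgebraicGeometry.Frobenioids.DivisorMonoidCategoryTheoreticityThm42FSM
import Literature.AlgebraicGeometry.Frobenioids.EquivalenceFrobeniusQuasiIsotropic
import Literature.AlgebraicGeometry.Frobenioids.EquivalenceUnitsTransport
import HarnessLib

/-!
# Frobenioids I, Theorem 4.2 (i) AS TYPED (`PreFrobenioidData.Thm42i`), for Frobenioids of perfect type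
# over bases of FSM-type — the assembly of sub-DAG rows T42-L01, L02, L07, L11

Mochizuki, *The geometry of Frobenioids I: the general theory*, Kyushu J. Math. **62** (2008)
293–400, Thm. 4.2 (i), kurims text p. 77 (statement), proof pp. 78–81
[cite: MochizukiFrdI2008, Thm. 4.2 (i) p.77]: "`Ψ` preserves primary steps, Div-identity endomorphisms,
Div-Frobenius-trivial objects and universally Div-Frobenius-trivial objects."

PROOF-ONLY assembly (seat abc-iut-w4-d090, filer-of-record of the Thm. 4.2 closeout, L1-lead R81 (4); row
`FrdI:Thm4.2/T42-L00` (i) of `plan/L1/SUBDAG-FrdI-Thm42-Thm49.md`). For Frobenioids `C_i → F_{Φ_i}` of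
PERFECT type with `Φ_i` perf-factorial over bases `D_i` of FSM-type (the cell's repaired reading of
print's "FSMFF-type", residual R2 of `plan/GAP-LEDGER.md`), the typed statement `Thm42i` of
`DivisorMonoidCategoryTheoreticityDefs.lean` (seat abc-iut-L1-t3) HOLDS:

* `FrdI.T42.setting_of_perfectType_of_isOfFSMType` — the hypotheses-structure `FrdI.T42.Setting` of the
  proof (seat abc-iut-L1-t14) BUILT from "perfect + isotropic + standard type, non-group-like objects
  exist, bases of FSM-type": Thm. 3.4 (ii) (pre-steps, steps: seat abc-iut-L1-t13's
  `FrdI.isPreStep_map_of_isOfFSMType`, `PreFrobenioidData.isStep_map_of_isOfFSMType`) and Thm. 3.4 (iii)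
  (Frobenius type, degrees, pull-back morphisms: abc-iut-L1-t13's `FrdI.isFrobeniusType_map_quasiIsotropic`,
  `FrdI.degFr_map`, `FrdI.isPullbackMorphism_map_quasiIsotropic`), each also for `Ψ⁻¹`;
* `FrdI.T42.thm42i_of_perfectType_of_isOfFSMType` — **Thm. 4.2 (i) as typed**: primary steps by row L07
  (`Setting.isPrimaryPreStep_map`, seat abc-iut-w4-d099), Div-identity endomorphisms by row L11
  (`preservesDivIdentity_holds`, seat abc-iut-w4-d068) at non-group-like objects and row L01 at
  group-like ones (`Setting.isGroupLikeObj_map`), (universally) Div-Frobenius-trivial objects by row L02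
  (`preservesDivFrobTrivial_of_isDivIdentity_map`) resp. L01 (`GroupLikeObjectsWLOG`, seat abc-iut-L1-t2).

The general (non-perfect) case is the formal transport `FrdI.T42.PerfectWLOG_holds` (row L03) through the
perfections, modulo the cone nodes "`C^pf` is a Frobenioid of standard type" (Prop. 3.2 (iii), Prop. 5.5
(iii)) — not done here. No new definitions; no statement of the paper is strengthened.
-/

namespace Literature.AlgebraicGeometry.Frobenioids

namespace FrdI.T42

open CategoryTheory Opposite PreFrobenioidData

universe w v v' u u'

variable {D₁ : Type u} [Category.{v} D₁] {Φ₁ : D₁ᵒᵖ ⥤ CommMonCat.{w}} {C₁ : Type u'} [Category.{v'} C₁]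
  {D₂ : Type u} [Category.{v} D₂] {Φ₂ : D₂ᵒᵖ ⥤ CommMonCat.{w}} {C₂ : Type u'} [Category.{v'} C₂]
  {F₁ : C₁ ⥤ ElemFrobenioid Φ₁} {F₂ : C₂ ⥤ ElemFrobenioid Φ₂} (Ψ : C₁ ≌ C₂)

/-! ### The setting of the proof, built from the hypotheses of Thm. 4.2 in the perfect case -/

/-- **The setting of the proof of Thm. 4.2, for Frobenioids of perfect, isotropic and quasi-isotropic type
with `Φ_i` perf-factorial and non-dilating and with non-group-like objects, over bases of FSM-type**: the transports of Thm. 3.4 (ii)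
(pre-steps, steps) and (iii) (Frobenius type, Frobenius degrees, pull-back morphisms) along `Ψ` and `Ψ⁻¹`
are the cell's kernel theorems (seat abc-iut-L1-t13) (of "standard type" only quasi-isotropy and
non-dilation enter). [cite: MochizukiFrdI2008, Thm. 4.2 (i) p.78] -/
theorem setting_of_perfectType_of_isOfFSMType (hF₁ : PreFrobenioid.IsFrobenioid F₁)
    (hF₂ : PreFrobenioid.IsFrobenioid F₂) (hperf₁ : PreFrobenioid.IsOfPerfectType F₁)
    (hperf₂ : PreFrobenioid.IsOfPerfectType F₂) (hi₁ : PreFrobenioid.IsOfIsotropicType F₁)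
    (hi₂ : PreFrobenioid.IsOfIsotropicType F₂) (hpf₁ : Objectwise (fun M _ => IsPerfFactorial M) Φ₁)
    (hpf₂ : Objectwise (fun M _ => IsPerfFactorial M) Φ₂) (hq₁ : (ofFunctor Φ₁ F₁).IsOfQuasiIsotropicType)
    (hq₂ : (ofFunctor Φ₂ F₂).IsOfQuasiIsotropicType) (hnd₁ : IsNonDilatingOn Φ₁) (hnd₂ : IsNonDilatingOn Φ₂)
    (hD₁ : IsOfFSMType D₁) (hD₂ : IsOfFSMType D₂)
    (hN₁ : ∃ A : C₁, ¬ PreFrobenioid.IsGroupLikeObj F₁ A) (hN₂ : ∃ A : C₂, ¬ PreFrobenioid.IsGroupLikeObj F₂ A) :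
    Setting F₁ F₂ Ψ := by
  obtain ⟨N₁, hN₁⟩ := hN₁
  obtain ⟨N₂, hN₂⟩ := hN₂
  exact
    { isFrobenioid₁ := hF₁
      isFrobenioid₂ := hF₂
      perfect₁ := hperf₁
      perfect₂ := hperf₂
      isotropic₁ := hi₁
      isotropic₂ := hi₂
      perfFactorial₁ := hpf₁
      perfFactorial₂ := hpf₂
      preStep_map := fun _ _ _ h => FrdI.isPreStep_map_of_isOfFSMType hF₁ hF₂ hi₁ hi₂ hD₂ Ψ h
      preStep_inv := fun _ _ _ h => FrdI.isPreStep_map_of_isOfFSMType hF₂ hF₁ hi₂ hi₁ hD₁ Ψ.symm h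
      step_map := fun _ _ _ h => PreFrobenioidData.isStep_map_of_isOfFSMType (Ψ := Ψ) hF₁ hF₂ hi₁ hi₂ hD₂ h
      step_inv := fun _ _ _ h => PreFrobenioidData.isStep_map_of_isOfFSMType (Ψ := Ψ.symm) hF₂ hF₁ hi₂ hi₁ hD₁ h
      frobeniusType_map := fun _ _ _ h => FrdI.isFrobeniusType_map_quasiIsotropic hF₁ hF₂ hq₁
        hq₂ hD₁ hD₂ hnd₁ hnd₂ Ψ hN₁ hN₂ h
      frobeniusType_inv := fun _ _ _ h => FrdI.isFrobeniusType_map_quasiIsotropic hF₂ hF₁ hq₂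
        hq₁ hD₂ hD₁ hnd₂ hnd₁ Ψ.symm hN₂ hN₁ h
      degFr_map := fun _ _ φ => FrdI.degFr_map hF₁ hF₂ hq₁ hq₂ hD₁ hD₂ hnd₁ hnd₂ Ψ hN₁ hN₂ φ
      pullback_map := fun _ _ _ h => FrdI.isPullbackMorphism_map_quasiIsotropic hF₁ hF₂ hq₁
        hq₂ hD₁ hD₂ hnd₁ hnd₂ Ψ hN₁ hN₂ h
      pullback_inv := fun _ _ _ h => FrdI.isPullbackMorphism_map_quasiIsotropic hF₂ hF₁ hq₂
        hq₁ hD₂ hD₁ hnd₂ hnd₁ Ψ.symm hN₂ hN₁ h }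

/-! ### Theorem 4.2 (i) as typed, perfect case over FSM-type bases -/

/-- **Theorem 4.2 (i) AS TYPED (`PreFrobenioidData.Thm42i`), for Frobenioids of perfect type with `Φ_i`
perf-factorial over bases of FSM-type**: under the typed hypotheses `Thm42Setting` (standard and isotropic
type, not of group-like type), `Ψ` preserves the steps that are primary pre-steps (row L07), Div-identity
endomorphisms (rows L11 / L01), Div-Frobenius-trivial objects and universally Div-Frobenius-trivial
objects (rows L02 / L01). [cite: MochizukiFrdI2008, Thm. 4.2 (i) p.77] -/
theorem thm42i_of_perfectType_of_isOfFSMType (hF₁ : PreFrobenioid.IsFrobenioid F₁)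
    (hF₂ : PreFrobenioid.IsFrobenioid F₂) (hperf₁ : PreFrobenioid.IsOfPerfectType F₁)
    (hperf₂ : PreFrobenioid.IsOfPerfectType F₂) (hpf₁ : Objectwise (fun M _ => IsPerfFactorial M) Φ₁)
    (hpf₂ : Objectwise (fun M _ => IsPerfFactorial M) Φ₂) (hD₁ : IsOfFSMType D₁) (hD₂ : IsOfFSMType D₂) :
    (ofFunctor Φ₁ F₁).Thm42i (ofFunctor Φ₂ F₂) Ψ := by
  intro hT
  obtain ⟨⟨hs₁, hs₂⟩, ⟨hi₁', hi₂'⟩, ⟨hng₁, hng₂⟩⟩ := hT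
  have hi₁ : PreFrobenioid.IsOfIsotropicType F₁ := (ofFunctor_isOfIsotropicType F₁).1 hi₁'
  have hi₂ : PreFrobenioid.IsOfIsotropicType F₂ := (ofFunctor_isOfIsotropicType F₂).1 hi₂'
  have hN₁ : ∃ A : C₁, ¬ PreFrobenioid.IsGroupLikeObj F₁ A := by
    by_contra h
    exact hng₁ ⟨fun A => (ofFunctor_isGroupLikeObj F₁ A).2 (not_exists_not.mp h A)⟩
  have hN₂ : ∃ A : C₂, ¬ PreFrobenioid.IsGroupLikeObj F₂ A := by
    by_contra h
    exact hng₂ ⟨fun A => (ofFunctor_isGroupLikeObj F₂ A).2 (not_exists_not.mp h A)⟩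
  have hnd₁ := isNonDilatingOn_of_ofFunctor hs₁.nonDilating
  have hnd₂ := isNonDilatingOn_of_ofFunctor hs₂.nonDilating
  have S : Setting F₁ F₂ Ψ := setting_of_perfectType_of_isOfFSMType Ψ hF₁ hF₂ hperf₁ hperf₂ hi₁ hi₂ hpf₁
    hpf₂ hs₁.quasiIsotropic hs₂.quasiIsotropic hnd₁ hnd₂ hD₁ hD₂ hN₁ hN₂
  -- `Ψ` preserves group-like objects (row L01 / Thm. 3.4 (ii))
  have hgl : ∀ ⦃A : C₁⦄, PreFrobenioid.IsGroupLikeObj F₁ A → PreFrobenioid.IsGroupLikeObj F₂ (Ψ.functor.obj A) :=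
    fun _ h => S.isGroupLikeObj_map h
  -- row L11: Div-identity endomorphisms of non-group-like objects
  have hdivid : ∀ (A : C₁), ¬ PreFrobenioid.IsGroupLikeObj F₁ A → ∀ α : A ⟶ A,
      PreFrobenioid.IsDivIdentity F₁ α → PreFrobenioid.IsDivIdentity F₂ (Ψ.functor.map α) :=
    fun A hA α hα => preservesDivIdentity_holds F₁ F₂ Ψ S hnd₁ hnd₂ (fun _ _ _ h => S.isPrimaryPreStep_map h)
      (fun _ _ _ h => S.isPrimaryPreStep_inverse_map h) A hA α hα
  -- row L02: (universally) Div-Frobenius-trivial non-group-like objects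
  obtain ⟨-, hb, hc⟩ := preservesDivFrobTrivial_of_isDivIdentity_map S hdivid
  refine ⟨fun X Y φ hφ => ⟨S.step_map φ hφ.1, S.isPrimaryPreStep_map hφ.2⟩, fun A α hα => ?_,
    fun A hA => ?_, fun A hA => ?_⟩
  · -- Div-identity endomorphisms
    rw [ofFunctor_isDivIdentity F₁] at hα
    rw [ofFunctor_isDivIdentity F₂]
    by_cases hgA : PreFrobenioid.IsGroupLikeObj F₁ A
    · exact PreFrobenioid.isDivIdentity_map_of_isGroupLikeObj Ψ.functor hgl hgA α
    · exact hdivid A hgA α hα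
  · -- Div-Frobenius-trivial objects
    rw [ofFunctor_isDivFrobeniusTrivial F₁] at hA
    rw [ofFunctor_isDivFrobeniusTrivial F₂]
    by_cases hgA : PreFrobenioid.IsGroupLikeObj F₁ A
    · exact PreFrobenioid.isDivFrobeniusTrivial_map_of_isGroupLikeObj Ψ.functor hF₂ hi₂ hgl hgA
    · exact hb A hgA hA
  · -- universally Div-Frobenius-trivial objects
    have hA' : PreFrobenioid.IsUniversallyDivFrobeniusTrivial F₁ A := fun A' φ hφ =>
      (ofFunctor_isDivFrobeniusTrivial F₁ A').1 (hA φ ((ofFunctor_isPullbackMorphism F₁ φ).2 hφ))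
    intro A₂ ψ hψ
    rw [ofFunctor_isDivFrobeniusTrivial F₂]
    have hψ' := (ofFunctor_isPullbackMorphism F₂ ψ).1 hψ
    by_cases hgA : PreFrobenioid.IsGroupLikeObj F₁ A
    · exact PreFrobenioid.isUniversallyDivFrobeniusTrivial_map_of_isGroupLikeObj Ψ.functor hF₂ hi₂ hgl hgA ψ hψ'
    · exact hc A hgA hA' ψ hψ'

end FrdI.T42

end Literature.AlgebraicGeometry.Frobenioids
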